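import Summits.QuantumAdvantage.QuantumAdvantage.Theorems.SymplecticPurityDlogGraphFlatHolder
import Mathlib.Analysis.SpecialFunctions.Pow.Real

/-!
# Crux `DlogGraphFlat` (stmt-QuantumAdvantage-10732), line `Sketch` — sector B, stub P2:
# the pair dilation sum from height decay (`stub_dlogPairOfDecay`)

From the (g-free) height-decay hypothesis P1 — every `r ∈ 𝔽_pˣ` has a representation `b·r = a`
(`a ∈ ℤ`, `b ≥ 1`) with `|Σ_λ F_β(λ)F_β(λr)| ≤ C p (max(|a|,b)^(−c') + p^(−η₀))` — we derive the
pair-sum bound `Σ_{0<h<2^m} |Σ_λ F_β(λ)F_β(λ gʰ)| ≤ 20 C · 2^((1−κ₁)m) · p` for `m ≤ μ₁ n`, with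
`κ₁ = c'/(2+c')`, `μ₁ = min(η₀/2, 1)`.

Proof: one threshold `τ = 2^(m/(2+c'))`.
* exponents `h` whose representation has height `> τ` contribute `≤ C p (τ^(−c') + p^(−η₀))` each,
  and there are `< 2^m` of them; `2^m τ^(−c') = 2^((1−κ₁)m)` and `2^m p^(−η₀) ≤ 2^((1−κ₁)m)` since
  `p ≥ 2^(n−1)` (window) and `κ₁ m ≤ η₀ (n − 1)`;
* exponents of height `≤ τ` contribute `≤ 2 C p` each, and there are at most `2·(2N+1)·N ≤ 6τ²`
  of them (`N = ⌊τ⌋`): `h ↦ (a_h, b_h)` lands in a box of that size and has fibres of size `≤ 2`,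
  because equal `(a, b)` with `b ≢ 0 (mod p)` forces `gʰ = gʰ'`, i.e. `h ≡ h' (mod p − 1)` (`g` is
  primitive), and `2^m ≤ 2(p − 1)` (`card_filter_pow_eq_le_two`, adapted from
  `stub_dlogOrbitFibre`).
No new definitions.
-/

set_option linter.dupNamespace false -- D-0017: single-problem summit ⇒ `QuantumAdvantage.QuantumAdvantage` by design

namespace Summit.QuantumAdvantage.QuantumAdvantage.Theorems.SymplecticPurity

open Finset Literature.Computability.QuantumComplexity Literature.Computability.Cryptography

section PairOfDecay

/-- At most two exponents `h < L ≤ 2(p − 1)` give the same power of a primitive root `g` mod `p`. -/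
theorem card_filter_pow_eq_le_two {p g : ℕ} [Fact p.Prime] (hg : orderOf (g : ZMod p) = p - 1)
    {L : ℕ} (hL : L ≤ 2 * (p - 1)) (c : ZMod p) :
    ((Finset.range L).filter fun h => (g : ZMod p) ^ h = c).card ≤ 2 := by
  -- adapted from `stub_dlogOrbitFibre` (…DlogGraphFlatOrbitFibre): inject into `range 2` by the
  -- quotient `h / (p - 1)`; equal powers have equal residues mod `p - 1`.
  have hp : p.Prime := Fact.out
  have hp1 : 0 < p - 1 := by have := hp.two_le; omega
  have hfin : IsOfFinOrder (g : ZMod p) := by rw [← orderOf_pos_iff, hg]; exact hp1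
  calc ((Finset.range L).filter fun h => (g : ZMod p) ^ h = c).card
      ≤ (Finset.range 2).card := by
        refine Finset.card_le_card_of_injOn (fun h => h / (p - 1)) ?_ ?_
        · intro h hh
          have hh' := Finset.mem_filter.mp (Finset.mem_coe.mp hh)
          have hhL : h < L := Finset.mem_range.mp hh'.1
          have hlt : h / (p - 1) < 2 :=
            Nat.div_lt_of_lt_mul (by rw [Nat.mul_comm]; exact lt_of_lt_of_le hhL hL)
          simpa only [Finset.coe_range, Set.mem_Iio] using hlt
        · intro h hh h' hh' hq
          have e : (g : ZMod p) ^ h = (g : ZMod p) ^ h' :=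
            (Finset.mem_filter.mp (Finset.mem_coe.mp hh)).2.trans
              (Finset.mem_filter.mp (Finset.mem_coe.mp hh')).2.symm
          have hr : h % (p - 1) = h' % (p - 1) := by
            have hr := hfin.pow_inj_mod.mp e
            rwa [hg] at hr
          rw [← Nat.mod_add_div h (p - 1), ← Nat.mod_add_div h' (p - 1), hr]
          exact congrArg (fun q => h' % (p - 1) + (p - 1) * q) hq
    _ = 2 := Finset.card_range 2

/-- Key count: among `h < L ≤ 2(p − 1)`, at most `2·(2N+1)·N` admit the chosen representation
`b_h · gʰ = a_h` with height `|a_h|, b_h ≤ N < p` (and `b_h ≥ 1`): the map `h ↦ (a_h, b_h)` lands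
in a box with `(2N+1)·N` points and, `g` being primitive, has fibres of size at most two. -/
theorem card_small_height_le {p g : ℕ} [Fact p.Prime] (hg : orderOf (g : ZMod p) = p - 1)
    {L N : ℕ} (hL : L ≤ 2 * (p - 1)) (hNp : N < p) (a : ℕ → ℤ) (b : ℕ → ℕ)
    (hab : ∀ h, ((b h : ℕ) : ZMod p) * (g : ZMod p) ^ h = ((a h : ℤ) : ZMod p)) :
    ((Finset.range L).filter fun h => (a h).natAbs ≤ N ∧ 0 < b h ∧ b h ≤ N).card ≤
      2 * ((2 * N + 1) * N) := by
  classical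
  have hbox : (Finset.Icc (-(N : ℤ)) N ×ˢ Finset.Icc 1 N).card = (2 * N + 1) * N := by
    have h1 : ((N : ℤ) + 1 - -(N : ℤ)).toNat = 2 * N + 1 := by omega
    rw [Finset.card_product, Int.card_Icc, Nat.card_Icc, h1, Nat.add_sub_cancel]
  rw [← hbox]
  refine Finset.card_le_mul_card_image_of_maps_to (f := fun h => (a h, b h)) ?_ 2 ?_
  · intro h hh
    simp only [Finset.mem_filter, Finset.mem_range] at hh
    simp only [Finset.mem_product, Finset.mem_Icc]
    omega
  · rintro ⟨a₀, b₀⟩ hmem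
    simp only [Finset.mem_product, Finset.mem_Icc] at hmem
    have hb0 : ((b₀ : ℕ) : ZMod p) ≠ 0 := by
      rw [Ne, ZMod.natCast_eq_zero_iff]
      exact fun hdvd => absurd (Nat.le_of_dvd (by omega) hdvd) (by omega)
    refine le_trans (Finset.card_le_card fun h hh => ?_)
      (card_filter_pow_eq_le_two hg hL (((b₀ : ℕ) : ZMod p)⁻¹ * ((a₀ : ℤ) : ZMod p)))
    simp only [Finset.mem_filter, Finset.mem_range, Prod.mk.injEq] at hh ⊢
    obtain ⟨⟨hhL, -⟩, ha0, hb0'⟩ := hh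
    subst ha0 hb0'
    exact ⟨hhL, (eq_inv_mul_iff_mul_eq₀ hb0).mpr (hab h)⟩

/-- The counting argument behind `stub_dlogPairOfDecay`, for an arbitrary correlation function
`S : 𝔽_p → ℝ` obeying the height-decay bound: `Σ_{0<h<2^m} |S(gʰ)| ≤ 20 C 2^((1−κ₁)m) p`. -/
theorem pair_sum_le_of_decay {c' η₀ C : ℝ} (hc' : 0 < c') (hη₀ : 0 < η₀) (hC : 0 < C) {n : ℕ}
    (hn : 8 ≤ n) {p : ℕ} [Fact p.Prime] {g : ℕ} (hwin : 2 ^ n ≤ p + 2 ^ (53 * n / 100))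
    (hg : orderOf (g : ZMod p) = p - 1) {m : ℕ} (hm : (m : ℝ) ≤ min (η₀ / 2) 1 * (n : ℝ))
    {S : ZMod p → ℝ}
    (hdec : ∀ r : ZMod p, r ≠ 0 → ∃ a : ℤ, ∃ b : ℕ, 0 < b ∧ (b : ZMod p) * r = (a : ZMod p) ∧
      |S r| ≤ C * (p : ℝ) * ((max (|(a : ℝ)|) (b : ℝ)) ^ (-c') + (p : ℝ) ^ (-η₀))) :
    ∑ h ∈ Finset.Ico 1 (2 ^ m), |S ((g : ZMod p) ^ h)| ≤
      20 * C * (2 : ℝ) ^ ((1 - c' / (2 + c')) * (m : ℝ)) * (p : ℝ) := by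
  classical
  have hpp : p.Prime := Fact.out
  -- window arithmetic: `p ≥ 3·2^(n-2)`, so `2^n ≤ 2(p-1)`
  have hX : 2 ^ n = 2 ^ (n - 2) * 4 := by
    rw [show (4 : ℕ) = 2 ^ 2 by norm_num, ← pow_add, Nat.sub_add_cancel (by omega)]
  have hY : 2 ^ (53 * n / 100) ≤ 2 ^ (n - 2) := Nat.pow_le_pow_right (by norm_num) (by omega)
  have hX1 : 1 ≤ 2 ^ (n - 2) := Nat.one_le_two_pow
  have h2p : 2 ^ n ≤ 2 * (p - 1) := by omega
  -- `m ≤ n`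
  have hmn' : (m : ℝ) ≤ n :=
    hm.trans (mul_le_of_le_one_left (Nat.cast_nonneg n) (min_le_right _ _))
  have hmn : m ≤ n := by exact_mod_cast hmn'
  have hL : 2 ^ m ≤ 2 * (p - 1) := (Nat.pow_le_pow_right (by norm_num) hmn).trans h2p
  -- `g` is a unit mod `p`
  have hG0 : (g : ZMod p) ≠ 0 := by
    intro h0
    rw [h0, orderOf_zero] at hg
    have := hpp.two_le
    omega
  -- real-number facts about `p`
  have hp0 : (0 : ℝ) < p := by exact_mod_cast hpp.pos
  have hp1 : (1 : ℝ) ≤ p := by exact_mod_cast hpp.one_lt.le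
  have hp2 : (2 : ℝ) ^ ((n : ℝ) - 1) ≤ p := by
    rw [Real.rpow_sub (by norm_num), Real.rpow_natCast, Real.rpow_one, div_le_iff₀ (by norm_num)]
    exact_mod_cast (by omega : 2 ^ n ≤ p * 2)
  -- the chosen representations
  have hex : ∀ h : ℕ, ∃ a : ℤ, ∃ b : ℕ, 0 < b ∧ (b : ZMod p) * (g : ZMod p) ^ h = (a : ZMod p) ∧
      |S ((g : ZMod p) ^ h)| ≤
        C * (p : ℝ) * ((max (|(a : ℝ)|) (b : ℝ)) ^ (-c') + (p : ℝ) ^ (-η₀)) :=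
    fun h => hdec _ (pow_ne_zero h hG0)
  choose a b hb hab hbd using hex
  -- the threshold `τ = 2^(m/(2+c'))`, its integer part `N`, and the target size `E = 2^((1-κ₁)m)`
  obtain ⟨τ, hτ⟩ : ∃ τ : ℝ, τ = (2 : ℝ) ^ ((m : ℝ) / (2 + c')) := ⟨_, rfl⟩
  obtain ⟨E, hE⟩ : ∃ E : ℝ, E = (2 : ℝ) ^ ((1 - c' / (2 + c')) * (m : ℝ)) := ⟨_, rfl⟩
  have h2c : (2 + c' : ℝ) ≠ 0 := by positivity
  have hτ1 : 1 ≤ τ := hτ ▸ Real.one_le_rpow (by norm_num) (by positivity)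
  have hτ0 : 0 ≤ τ := zero_le_one.trans hτ1
  have hτpos : 0 < τ := zero_lt_one.trans_le hτ1
  have hE0 : 0 ≤ E := hE ▸ Real.rpow_nonneg (by norm_num) _
  have hτE : τ ^ 2 = E := by
    rw [hτ, hE, ← Real.rpow_natCast, ← Real.rpow_mul (by norm_num : (0 : ℝ) ≤ 2)]
    congr 1
    push_cast
    field_simp
    ring
  have hLτ : (2 : ℝ) ^ m * τ ^ (-c') = E := by
    rw [hτ, hE, ← Real.rpow_natCast, ← Real.rpow_mul (by norm_num : (0 : ℝ) ≤ 2),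
      ← Real.rpow_add (by norm_num : (0 : ℝ) < 2)]
    congr 1
    field_simp
    ring
  -- `2^m p^(-η₀) ≤ E`, i.e. `2^(κ₁ m) ≤ p^η₀`, from `p ≥ 2^(n-1)` and `κ₁ m ≤ η₀ (n-1)`
  have hκ1 : c' / (2 + c') ≤ 1 := by rw [div_le_one (by positivity)]; linarith
  have hkm : c' / (2 + c') * m ≤ ((n : ℝ) - 1) * η₀ := by
    have h1 : c' / (2 + c') * m ≤ m := mul_le_of_le_one_left (Nat.cast_nonneg m) hκ1
    have h2 : (m : ℝ) ≤ η₀ / 2 * n :=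
      hm.trans (mul_le_mul_of_nonneg_right (min_le_left _ _) (Nat.cast_nonneg n))
    have hn2 : (2 : ℝ) ≤ n := by exact_mod_cast (by omega : 2 ≤ n)
    nlinarith [mul_nonneg hη₀.le (sub_nonneg.2 hn2)]
  have hkey : (2 : ℝ) ^ (c' / (2 + c') * m) ≤ (p : ℝ) ^ η₀ :=
    calc (2 : ℝ) ^ (c' / (2 + c') * m) ≤ (2 : ℝ) ^ (((n : ℝ) - 1) * η₀) :=
          Real.rpow_le_rpow_of_exponent_le (by norm_num) hkm
      _ = ((2 : ℝ) ^ ((n : ℝ) - 1)) ^ η₀ := Real.rpow_mul (by norm_num) _ _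
      _ ≤ (p : ℝ) ^ η₀ := Real.rpow_le_rpow (by positivity) hp2 hη₀.le
  have hLp : (2 : ℝ) ^ m * (p : ℝ) ^ (-η₀) ≤ E := by
    have h2m : (2 : ℝ) ^ m = E * (2 : ℝ) ^ (c' / (2 + c') * m) := by
      rw [hE, ← Real.rpow_natCast, ← Real.rpow_add (by norm_num : (0 : ℝ) < 2)]
      congr 1
      ring
    rw [h2m, Real.rpow_neg hp0.le, mul_assoc]
    refine mul_le_of_le_one_right hE0 ?_
    rw [← div_eq_mul_inv, div_le_one (Real.rpow_pos_of_pos hp0 _)]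
    exact hkey
  -- `N = ⌊τ⌋ < p`
  obtain ⟨N, hN⟩ : ∃ N : ℕ, N = ⌊τ⌋₊ := ⟨_, rfl⟩
  have hNτ : (N : ℝ) ≤ τ := hN ▸ Nat.floor_le hτ0
  have hτp : τ < p := by
    have h1 : (m : ℝ) / (2 + c') ≤ m / 2 :=
      div_le_div_of_nonneg_left (Nat.cast_nonneg m) two_pos (by linarith)
    have hn4 : (4 : ℝ) ≤ n := by exact_mod_cast (by omega : 4 ≤ n)
    have hexp : (m : ℝ) / (2 + c') < (n : ℝ) - 1 := by linarith
    calc τ = (2 : ℝ) ^ ((m : ℝ) / (2 + c')) := hτ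
      _ < (2 : ℝ) ^ ((n : ℝ) - 1) := (Real.rpow_lt_rpow_left_iff one_lt_two).mpr hexp
      _ ≤ p := hp2
  have hNp : N < p := by exact_mod_cast hNτ.trans_lt hτp
  -- small heights: few exponents, trivial bound `2 C p` each
  have hSmall : ∑ h ∈ (Finset.Ico 1 (2 ^ m)).filter (fun h => max |(a h : ℝ)| (b h : ℝ) ≤ τ),
      |S ((g : ZMod p) ^ h)| ≤ 12 * C * E * p := by
    have hle : ∀ h ∈ (Finset.Ico 1 (2 ^ m)).filter (fun h => max |(a h : ℝ)| (b h : ℝ) ≤ τ),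
        |S ((g : ZMod p) ^ h)| ≤ 2 * C * p := by
      intro h _
      have hM1 : (1 : ℝ) ≤ max |(a h : ℝ)| (b h : ℝ) :=
        le_max_of_le_right (by exact_mod_cast hb h)
      have h1 : (max |(a h : ℝ)| (b h : ℝ)) ^ (-c') ≤ 1 :=
        Real.rpow_le_one_of_one_le_of_nonpos hM1 (by linarith)
      have h2 : (p : ℝ) ^ (-η₀) ≤ 1 := Real.rpow_le_one_of_one_le_of_nonpos hp1 (by linarith)
      calc |S ((g : ZMod p) ^ h)| ≤ _ := hbd h
        _ ≤ C * p * (1 + 1) := by gcongr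
        _ = 2 * C * p := by ring
    have hcard : ((((Finset.Ico 1 (2 ^ m)).filter
        (fun h => max |(a h : ℝ)| (b h : ℝ) ≤ τ)).card : ℕ) : ℝ) ≤ 6 * E := by
      have hsub : (Finset.Ico 1 (2 ^ m)).filter (fun h => max |(a h : ℝ)| (b h : ℝ) ≤ τ) ⊆
          (Finset.range (2 ^ m)).filter (fun h => (a h).natAbs ≤ N ∧ 0 < b h ∧ b h ≤ N) := by
        intro h hh
        simp only [Finset.mem_filter, Finset.mem_Ico, Finset.mem_range] at hh ⊢
        obtain ⟨⟨-, hhL⟩, hP⟩ := hh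
        have ha : |(a h : ℝ)| ≤ τ := le_trans (le_max_left _ _) hP
        have hb' : ((b h : ℕ) : ℝ) ≤ τ := le_trans (le_max_right _ _) hP
        refine ⟨hhL, hN ▸ Nat.le_floor ?_, hb h, hN ▸ Nat.le_floor hb'⟩
        rw [Nat.cast_natAbs, Int.cast_abs]
        exact ha
      have hc1 := (Finset.card_le_card hsub).trans (card_small_height_le hg hL hNp a b hab)
      have hc2 : ((((Finset.Ico 1 (2 ^ m)).filter
          (fun h => max |(a h : ℝ)| (b h : ℝ) ≤ τ)).card : ℕ) : ℝ) ≤ 2 * ((2 * N + 1) * N) := by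
        exact_mod_cast hc1
      rw [← hτE]
      nlinarith [mul_nonneg (sub_nonneg.2 hNτ) (add_nonneg hτ0 (Nat.cast_nonneg N)),
        mul_nonneg (sub_nonneg.2 hτ1) hτ0, Nat.cast_nonneg (α := ℝ) N]
    calc ∑ h ∈ (Finset.Ico 1 (2 ^ m)).filter (fun h => max |(a h : ℝ)| (b h : ℝ) ≤ τ),
          |S ((g : ZMod p) ^ h)|
        ≤ ((Finset.Ico 1 (2 ^ m)).filter (fun h => max |(a h : ℝ)| (b h : ℝ) ≤ τ)).card •
            (2 * C * p) := Finset.sum_le_card_nsmul _ _ _ hle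
      _ = (((Finset.Ico 1 (2 ^ m)).filter (fun h => max |(a h : ℝ)| (b h : ℝ) ≤ τ)).card : ℝ) *
            (2 * C * p) := nsmul_eq_mul _ _
      _ ≤ 6 * E * (2 * C * p) := mul_le_mul_of_nonneg_right hcard (by positivity)
      _ = 12 * C * E * p := by ring
  -- large heights: the decay bound `C p (τ^(-c') + p^(-η₀))` each, at most `2^m` exponents
  have hBig : ∑ h ∈ (Finset.Ico 1 (2 ^ m)).filter (fun h => ¬ max |(a h : ℝ)| (b h : ℝ) ≤ τ),
      |S ((g : ZMod p) ^ h)| ≤ 2 * C * E * p := by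
    have hle : ∀ h ∈ (Finset.Ico 1 (2 ^ m)).filter (fun h => ¬ max |(a h : ℝ)| (b h : ℝ) ≤ τ),
        |S ((g : ZMod p) ^ h)| ≤ C * p * (τ ^ (-c') + (p : ℝ) ^ (-η₀)) := by
      intro h hh
      have hτM : τ < max |(a h : ℝ)| (b h : ℝ) := not_le.mp (Finset.mem_filter.mp hh).2
      have h1 : (max |(a h : ℝ)| (b h : ℝ)) ^ (-c') ≤ τ ^ (-c') :=
        Real.rpow_le_rpow_of_nonpos hτpos hτM.le (by linarith)
      calc |S ((g : ZMod p) ^ h)| ≤ _ := hbd h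
        _ ≤ C * p * (τ ^ (-c') + (p : ℝ) ^ (-η₀)) := by gcongr
    have hcard : ((((Finset.Ico 1 (2 ^ m)).filter
        (fun h => ¬ max |(a h : ℝ)| (b h : ℝ) ≤ τ)).card : ℕ) : ℝ) ≤ (2 : ℝ) ^ m := by
      have : ((Finset.Ico 1 (2 ^ m)).filter (fun h => ¬ max |(a h : ℝ)| (b h : ℝ) ≤ τ)).card ≤
          2 ^ m := (Finset.card_filter_le _ _).trans (by rw [Nat.card_Ico]; exact Nat.sub_le _ _)
      exact_mod_cast this
    calc ∑ h ∈ (Finset.Ico 1 (2 ^ m)).filter (fun h => ¬ max |(a h : ℝ)| (b h : ℝ) ≤ τ),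
          |S ((g : ZMod p) ^ h)|
        ≤ ((Finset.Ico 1 (2 ^ m)).filter (fun h => ¬ max |(a h : ℝ)| (b h : ℝ) ≤ τ)).card •
            (C * p * (τ ^ (-c') + (p : ℝ) ^ (-η₀))) := Finset.sum_le_card_nsmul _ _ _ hle
      _ = (((Finset.Ico 1 (2 ^ m)).filter (fun h => ¬ max |(a h : ℝ)| (b h : ℝ) ≤ τ)).card : ℝ) *
            (C * p * (τ ^ (-c') + (p : ℝ) ^ (-η₀))) := nsmul_eq_mul _ _
      _ ≤ (2 : ℝ) ^ m * (C * p * (τ ^ (-c') + (p : ℝ) ^ (-η₀))) :=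
          mul_le_mul_of_nonneg_right hcard (by positivity)
      _ = C * p * ((2 : ℝ) ^ m * τ ^ (-c') + (2 : ℝ) ^ m * (p : ℝ) ^ (-η₀)) := by ring
      _ ≤ C * p * (E + E) := mul_le_mul_of_nonneg_left (add_le_add hLτ.le hLp) (by positivity)
      _ = 2 * C * E * p := by ring
  -- assemble
  have hCEp : 0 ≤ C * E * p := by positivity
  calc ∑ h ∈ Finset.Ico 1 (2 ^ m), |S ((g : ZMod p) ^ h)|
      = ∑ h ∈ (Finset.Ico 1 (2 ^ m)).filter (fun h => max |(a h : ℝ)| (b h : ℝ) ≤ τ),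
            |S ((g : ZMod p) ^ h)| +
          ∑ h ∈ (Finset.Ico 1 (2 ^ m)).filter (fun h => ¬ max |(a h : ℝ)| (b h : ℝ) ≤ τ),
            |S ((g : ZMod p) ^ h)| := (Finset.sum_filter_add_sum_filter_not _ _ _).symm
    _ ≤ 12 * C * E * p + 2 * C * E * p := add_le_add hSmall hBig
    _ ≤ 20 * C * E * p := by linarith
    _ = 20 * C * (2 : ℝ) ^ ((1 - c' / (2 + c')) * (m : ℝ)) * (p : ℝ) := by rw [hE]

/-- **Stub P2 (sector B, provable from P1): the pair dilation sum along the short geometric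
progression** `Σ_(0<h<2^m) |Σ_λ F_β(λ)F_β(λ gʰ)| ≤ C 2^((1−κ₁)m) p` for `m ≤ μ₁ n`. From P1 by
trivial counting (at most `2(2T+1)T` exponents `h < 2^m` admit a representation of height `≤ T`:
distinct residues as `g` is primitive and `2^m ≤ 2(p − 1)`), one threshold `T = 2^(m/(2+c'))`,
and `2^m p^(1−η₀) ≤ 2^((1−κ₁)m) p` for `m ≤ μ₁ n`, `μ₁ = min(η₀/2, 1)`, `κ₁ = c'/(2+c')`. -/
theorem stub_dlogPairOfDecay :
    (∃ c' : ℝ, 0 < c' ∧ ∃ η₀ : ℝ, 0 < η₀ ∧ ∃ C : ℝ, 0 < C ∧ ∃ n₀ : ℕ, ∀ n ≥ n₀,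
      ∀ (p : ℕ) [Fact (Nat.Prime p)], p < 2 ^ n → 2 ^ n ≤ p + 2 ^ (53 * n / 100) →
      ∀ β : QReg n, β ≠ (fun _ => false) → ∀ r : ZMod p, r ≠ 0 →
      ∃ a : ℤ, ∃ b : ℕ, 0 < b ∧ (b : ZMod p) * r = (a : ZMod p) ∧
        |∑ lam : ZMod p,
          (∏ i : Fin n, (if β i && (lam).val.testBit (i : ℕ) then (-1 : ℝ) else 1)) *
          (∏ i : Fin n, (if β i && (lam * r).val.testBit (i : ℕ) then (-1 : ℝ) else 1))| ≤
        C * (p : ℝ) * ((max (|(a : ℝ)|) (b : ℝ)) ^ (-c') + (p : ℝ) ^ (-η₀))) →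
    ∃ κ₁ : ℝ, 0 < κ₁ ∧ ∃ μ₁ : ℝ, 0 < μ₁ ∧ ∃ C : ℝ, 0 < C ∧ ∃ n₀ : ℕ, ∀ n ≥ n₀,
      ∀ (p : ℕ) [Fact (Nat.Prime p)] (g : ℕ), p < 2 ^ n → 2 ^ n ≤ p + 2 ^ (53 * n / 100) →
      orderOf (g : ZMod p) = p - 1 →
      ∀ β : QReg n, β ≠ (fun _ => false) → ∀ m : ℕ, (m : ℝ) ≤ μ₁ * (n : ℝ) →
      ∑ h ∈ Finset.Ico 1 (2 ^ m),
        |∑ lam : ZMod p,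
          (∏ i : Fin n, (if β i && (lam).val.testBit (i : ℕ) then (-1 : ℝ) else 1)) *
          (∏ i : Fin n, (if β i && (lam * (g : ZMod p) ^ h).val.testBit (i : ℕ) then (-1 : ℝ) else 1))| ≤
        C * (2 : ℝ) ^ ((1 - κ₁) * (m : ℝ)) * (p : ℝ) := by
  rintro ⟨c', hc', η₀, hη₀, C, hC, n₀, hD⟩
  refine ⟨c' / (2 + c'), by positivity, min (η₀ / 2) 1, lt_min (by positivity) one_pos,
    20 * C, by positivity, max n₀ 8, ?_⟩
  intro n hn p hpf g hp hwin hg β hβ m hm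
  exact pair_sum_le_of_decay hc' hη₀ hC (le_of_max_le_right hn) hwin hg hm
    (S := fun r => ∑ lam : ZMod p,
      (∏ i : Fin n, (if β i && (lam).val.testBit (i : ℕ) then (-1 : ℝ) else 1)) *
      (∏ i : Fin n, (if β i && (lam * r).val.testBit (i : ℕ) then (-1 : ℝ) else 1)))
    (hD n (le_of_max_le_left hn) p hp hwin β hβ)

end PairOfDecay

end Summit.QuantumAdvantage.QuantumAdvantage.Theorems.SymplecticPurity
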